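import Summits.Ventures.PercRepro.C011

/-!
# PercRepro — the C-011 concavity lemma in its 6-mark form (typer-2, gen 3)

`proofs/LEAD-C011-concavity.md` §2–§3 (lead g3, hand derivation, numerically confirmed on 400 random
instances): along an edge `g = uv` the `t²`-coefficient of the slack `Φ⁺` of C-005⁺ is a quadratic
form in the probabilities of the MERGE TYPES of the configuration of `G − g` (the edge `g` forced
closed), read off the clusters `K_u`, `K_v` of the endpoints through `S = K_u ∩ M`, `T = K_v ∩ M`,
`M = {a, b, c, d}`:

* `Aᵢ`: all four marks separate, `{S, T} = {{p}, {q}}` with `{p, q}` a block of the crossing cell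
  `xᵢ` (opening `g`: `⊥ → R ⋖ xᵢ`);
* `Bᵢ`: the complementary block `{p′, q′}` connected, `p`, `q` separate, `{S, T} = {{p}, {q}}`
  (`R ⋖ xᵢ → xᵢ`);
* `Cᵢ`: `{p, q}` connected, the other two marks separate, `{S, T} = {{p, q}, {s}}` (`R → 3|1`);
* `Dᵢ`: the marked partition is `xᵢ` and `{S, T}` = its two blocks (`xᵢ → ⊤`);
* `E`: the marked partition is a `3|1` cell and `{S, T}` = its two blocks (`3|1 → ⊤`).

**`Concavity6Mark`** is the inequality of §3,
`½ Σ_{i≠j} P(Bᵢ)P(Bⱼ) + Σ_{i≠j} P(Bᵢ)P(Cⱼ) ≤ Σ_{i≠j} P(Aᵢ)P(Bⱼ) + Σᵢ P(Aᵢ)P(Dᵢ) + P(A)P(E)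
+ Σ_{i≠j} P(Cᵢ)P(Dⱼ) + ½ Σ_{i≠j} P(Dᵢ)P(Dⱼ)`, `P(A) = Σᵢ P(Aᵢ)`, for every finite multigraph, every
weight vector and every edge `g` (the type events do not depend on the coordinate `g`, so `prob p`
with the full `p` is the probability on `G − g`).  The bridge
`PhiPlus_edge_concave ⇐ Concavity6Mark` (the identity `Q⁺(Δ, Δ) = §3`, dossier §1–§2) is NOT proved
here — it is the provers' step; this file only fixes the statement.
-/

namespace PercRepro

open Finset

namespace MultiGraph

variable {V E : Type*} (G : MultiGraph V E) [DecidableEq E]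

/-- Connectivity in `G − g`: the edge `g` is forced closed. -/
def ConnWithout (g : E) (ω : Config E) (x y : V) : Prop :=
  G.Conn (Function.update ω g false) x y

variable {G} in
/-- `ConnWithout` is symmetric. -/
theorem ConnWithout.symm {g : E} {ω : Config E} {x y : V} (h : G.ConnWithout g ω x y) :
    G.ConnWithout g ω y x :=
  (show G.Conn (Function.update ω g false) x y from h).symm

variable {G} in
/-- `ConnWithout` is transitive. -/
theorem ConnWithout.trans {g : E} {ω : Config E} {x y z : V} (h₁ : G.ConnWithout g ω x y)
    (h₂ : G.ConnWithout g ω y z) : G.ConnWithout g ω x z :=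
  (show G.Conn (Function.update ω g false) x y from h₁).trans h₂

/-- The two blocks of the crossing cells `x₁ = ab|cd`, `x₂ = ac|bd`, `x₃ = ad|bc`. -/
def crossBlocks (a b c d : V) : Fin 3 → (V × V) × (V × V) :=
  ![((a, b), (c, d)), ((a, c), (b, d)), ((a, d), (b, c))]

section Types

variable (g : E) (a b c d : V)

/-- `{S, T} = {{p}, {q}}`-shaped attachment of the endpoints: `u ~ p ∧ v ~ q` or `u ~ q ∧ v ~ p`
(in `G − g`). -/
def linksPair (ω : Config E) (p q : V) : Prop :=
  (G.ConnWithout g ω (G.fst g) p ∧ G.ConnWithout g ω (G.snd g) q) ∨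
    (G.ConnWithout g ω (G.fst g) q ∧ G.ConnWithout g ω (G.snd g) p)

/-- The marked partition (in `G − g`) is the rank-1 cell `pq|s|s′`: `p ~ q`, all other pairs
separate. -/
def isRank1Cell (ω : Config E) (p q s s' : V) : Prop :=
  G.ConnWithout g ω p q ∧ ¬ G.ConnWithout g ω p s ∧ ¬ G.ConnWithout g ω p s' ∧
    ¬ G.ConnWithout g ω q s ∧ ¬ G.ConnWithout g ω q s' ∧ ¬ G.ConnWithout g ω s s'

/-- The marked partition (in `G − g`) is the crossing cell `pq|p′q′`. -/
def isCrossCell (ω : Config E) (p q p' q' : V) : Prop :=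
  G.ConnWithout g ω p q ∧ G.ConnWithout g ω p' q' ∧ ¬ G.ConnWithout g ω p p'

/-- The marked partition (in `G − g`) is the `3|1` cell `pqr|s`. -/
def isThreeOneCell (ω : Config E) (p q r s : V) : Prop :=
  G.ConnWithout g ω p q ∧ G.ConnWithout g ω q r ∧ ¬ G.ConnWithout g ω p s

/-- All four marks pairwise separate in `G − g`. -/
def sepAllFour (ω : Config E) : Prop :=
  ¬ G.ConnWithout g ω a b ∧ ¬ G.ConnWithout g ω a c ∧ ¬ G.ConnWithout g ω a d ∧
    ¬ G.ConnWithout g ω b c ∧ ¬ G.ConnWithout g ω b d ∧ ¬ G.ConnWithout g ω c d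

/-- **Type `Aᵢ`**: all four marks separate and the endpoints of `g` attach to the two vertices of
one block of `xᵢ` (opening `g` moves `⊥ → R ⋖ xᵢ`). -/
def typeA (i : Fin 3) : Set (Config E) :=
  {ω | G.sepAllFour g a b c d ω ∧
    (G.linksPair g ω (crossBlocks a b c d i).1.1 (crossBlocks a b c d i).1.2 ∨
      G.linksPair g ω (crossBlocks a b c d i).2.1 (crossBlocks a b c d i).2.2)}

/-- **Type `Bᵢ`**: one block of `xᵢ` is connected, the two vertices of the other block are separate
(the rank-1 cell below `xᵢ`), and the endpoints of `g` attach to those two vertices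
(`R ⋖ xᵢ → xᵢ`). -/
def typeB (i : Fin 3) : Set (Config E) :=
  {ω | (G.isRank1Cell g ω (crossBlocks a b c d i).2.1 (crossBlocks a b c d i).2.2
          (crossBlocks a b c d i).1.1 (crossBlocks a b c d i).1.2 ∧
        G.linksPair g ω (crossBlocks a b c d i).1.1 (crossBlocks a b c d i).1.2) ∨
       (G.isRank1Cell g ω (crossBlocks a b c d i).1.1 (crossBlocks a b c d i).1.2
          (crossBlocks a b c d i).2.1 (crossBlocks a b c d i).2.2 ∧
        G.linksPair g ω (crossBlocks a b c d i).2.1 (crossBlocks a b c d i).2.2)}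

/-- **Type `Cᵢ`**: one block `{p, q}` of `xᵢ` is connected, the other two marks are separate, and
the endpoints of `g` attach to the connected block and to one of the two other marks
(`R ⋖ xᵢ → 3|1`). -/
def typeC (i : Fin 3) : Set (Config E) :=
  {ω | (G.isRank1Cell g ω (crossBlocks a b c d i).1.1 (crossBlocks a b c d i).1.2
          (crossBlocks a b c d i).2.1 (crossBlocks a b c d i).2.2 ∧
        (G.linksPair g ω (crossBlocks a b c d i).1.1 (crossBlocks a b c d i).2.1 ∨
          G.linksPair g ω (crossBlocks a b c d i).1.1 (crossBlocks a b c d i).2.2)) ∨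
       (G.isRank1Cell g ω (crossBlocks a b c d i).2.1 (crossBlocks a b c d i).2.2
          (crossBlocks a b c d i).1.1 (crossBlocks a b c d i).1.2 ∧
        (G.linksPair g ω (crossBlocks a b c d i).2.1 (crossBlocks a b c d i).1.1 ∨
          G.linksPair g ω (crossBlocks a b c d i).2.1 (crossBlocks a b c d i).1.2))}

/-- **Type `Dᵢ`**: the marked partition is `xᵢ` and the endpoints of `g` attach to its two blocks
(`xᵢ → ⊤`). -/
def typeD (i : Fin 3) : Set (Config E) :=
  {ω | G.isCrossCell g ω (crossBlocks a b c d i).1.1 (crossBlocks a b c d i).1.2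
          (crossBlocks a b c d i).2.1 (crossBlocks a b c d i).2.2 ∧
        G.linksPair g ω (crossBlocks a b c d i).1.1 (crossBlocks a b c d i).2.1}

/-- **Type `E`**: the marked partition is a `3|1` cell and the endpoints of `g` attach to its two
blocks (`3|1 → ⊤`). -/
def typeE : Set (Config E) :=
  {ω | (G.isThreeOneCell g ω b c d a ∧ G.linksPair g ω b a) ∨
       (G.isThreeOneCell g ω a c d b ∧ G.linksPair g ω a b) ∨
       (G.isThreeOneCell g ω a b d c ∧ G.linksPair g ω a c) ∨
       (G.isThreeOneCell g ω a b c d ∧ G.linksPair g ω a d)}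

end Types

end MultiGraph

/-- **The concavity lemma of C-011 in its 6-mark form** (`proofs/LEAD-C011-concavity.md` §3): for
every finite multigraph, every `p ∈ [0,1]^E`, every four marks and every edge `g`, with
`P(·) = prob p (·)` of the merge types of `G − g`,
`½ Σ_{i≠j} P(Bᵢ)P(Bⱼ) + Σ_{i≠j} P(Bᵢ)P(Cⱼ) ≤ Σ_{i≠j} P(Aᵢ)P(Bⱼ) + Σᵢ P(Aᵢ)P(Dᵢ) + P(A)P(E)
+ Σ_{i≠j} P(Cᵢ)P(Dⱼ) + ½ Σ_{i≠j} P(Dᵢ)P(Dⱼ)` (`P(A) = Σᵢ P(Aᵢ)`).  By the dossier's §1–§2 this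
is `Q⁺(Δ, Δ) ≤ 0`, i.e. `PhiPlus_edge_concave`; that identity is not formalised here. -/
def Concavity6Mark : Prop :=
  ∀ {V E : Type} [Fintype E] [DecidableEq E] (G : MultiGraph V E) (p : E → ℝ), IsProb p →
    ∀ (a b c d : V) (g : E),
      (1 / 2 : ℝ) * (∑ i : Fin 3, ∑ j : Fin 3, if i ≠ j then
          prob p (G.typeB g a b c d i) * prob p (G.typeB g a b c d j) else 0) +
        (∑ i : Fin 3, ∑ j : Fin 3, if i ≠ j then
          prob p (G.typeB g a b c d i) * prob p (G.typeC g a b c d j) else 0) ≤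
      (∑ i : Fin 3, ∑ j : Fin 3, if i ≠ j then
          prob p (G.typeA g a b c d i) * prob p (G.typeB g a b c d j) else 0) +
        (∑ i : Fin 3, prob p (G.typeA g a b c d i) * prob p (G.typeD g a b c d i)) +
        (∑ i : Fin 3, prob p (G.typeA g a b c d i)) * prob p (G.typeE g a b c d) +
        (∑ i : Fin 3, ∑ j : Fin 3, if i ≠ j then
          prob p (G.typeC g a b c d i) * prob p (G.typeD g a b c d j) else 0) +
        (1 / 2 : ℝ) * (∑ i : Fin 3, ∑ j : Fin 3, if i ≠ j then
          prob p (G.typeD g a b c d i) * prob p (G.typeD g a b c d j) else 0)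

open Classical in
/-- The CLASS-LEVEL form of §3 (the previous lead's step (ii)): on every face `[v, u]` of the cube
of every marked multigraph, counting the ORDERED antipodal pairs `(ρ, ρᶜ)` of the face by their
types, `#{Bᵢ,Bⱼ} + 2·#{Bᵢ,Cⱼ} ≤ 2·#{Aᵢ,Bⱼ} + 2·#{Aᵢ,Dᵢ} + 2·#{A,E} + 2·#{Cᵢ,Dⱼ} + #{Dᵢ,Dⱼ}` (`i ≠ j`) —
the unordered inequality of the dossier times `2`: the symmetric classes `{B, B}`, `{D, D}` are
counted twice by ordered pairs, the others once. -/
def Concavity6MarkClass : Prop :=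
  ∀ {V E : Type} [Fintype E] [DecidableEq E] (G : MultiGraph V E) (a b c d : V) (g : E)
    (u v : Config E), v ≤ u →
      (∑ i : Fin 3, ∑ j : Fin 3, if i ≠ j then
          (Finset.univ.filter fun ρ : Config (Face u v) =>
            embed u v ρ ∈ G.typeB g a b c d i ∧ embed u v ρᶜ ∈ G.typeB g a b c d j).card else 0) +
        2 * (∑ i : Fin 3, ∑ j : Fin 3, if i ≠ j then
          (Finset.univ.filter fun ρ : Config (Face u v) =>
            embed u v ρ ∈ G.typeB g a b c d i ∧ embed u v ρᶜ ∈ G.typeC g a b c d j).card else 0) ≤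
      2 * (∑ i : Fin 3, ∑ j : Fin 3, if i ≠ j then
          (Finset.univ.filter fun ρ : Config (Face u v) =>
            embed u v ρ ∈ G.typeA g a b c d i ∧ embed u v ρᶜ ∈ G.typeB g a b c d j).card else 0) +
        2 * (∑ i : Fin 3, (Finset.univ.filter fun ρ : Config (Face u v) =>
            embed u v ρ ∈ G.typeA g a b c d i ∧ embed u v ρᶜ ∈ G.typeD g a b c d i).card) +
        2 * (∑ i : Fin 3, (Finset.univ.filter fun ρ : Config (Face u v) =>
            embed u v ρ ∈ G.typeA g a b c d i ∧ embed u v ρᶜ ∈ G.typeE g a b c d).card) +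
        2 * (∑ i : Fin 3, ∑ j : Fin 3, if i ≠ j then
          (Finset.univ.filter fun ρ : Config (Face u v) =>
            embed u v ρ ∈ G.typeC g a b c d i ∧ embed u v ρᶜ ∈ G.typeD g a b c d j).card else 0) +
        (∑ i : Fin 3, ∑ j : Fin 3, if i ≠ j then
          (Finset.univ.filter fun ρ : Config (Face u v) =>
            embed u v ρ ∈ G.typeD g a b c d i ∧ embed u v ρᶜ ∈ G.typeD g a b c d j).card else 0)

/-! ### From the class level to the product level -/

section Transfer

variable {E : Type*} [Fintype E] [DecidableEq E]

open Classical in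
/-- **A finite linear combination of products `P(X_k)·P(Y_k)` grouped by join and meet**: it is the
weighted sum over the faces `[v, u]` of the same combination of the ordered antipodal counts
`#{ρ : embed ρ ∈ X_k ∧ embed ρᶜ ∈ Y_k}` (the instance of `twoCopy_eq_sum_faces` at the kernel
`Σ_k α_k [ω ∈ X_k][ω′ ∈ Y_k]`). -/
theorem sum_prob_mul_prob_eq_sum_faces {ι : Type*} [Fintype ι] (p : E → ℝ) (α : ι → ℝ)
    (X Y : ι → Set (Config E)) :
    ∑ k, α k * (prob p (X k) * prob p (Y k)) =
      ∑ uv : Config E × Config E, weight p uv.2 * weight p uv.1 *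
        if uv.2 ≤ uv.1 then ∑ k, α k * ((Finset.univ.filter fun ρ : Config (Face uv.1 uv.2) =>
          embed uv.1 uv.2 ρ ∈ X k ∧ embed uv.1 uv.2 ρᶜ ∈ Y k).card : ℝ) else 0 := by
  have h1 : ∀ k, prob p (X k) * prob p (Y k) = ∑ ω : Config E, ∑ ω' : Config E,
      weight p ω * weight p ω' * (if ω ∈ X k ∧ ω' ∈ Y k then 1 else 0) := by
    intro k
    rw [prob, prob, Finset.sum_mul_sum]
    refine Finset.sum_congr rfl fun ω _ => Finset.sum_congr rfl fun ω' _ => ?_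
    rw [Set.indicator_apply, Set.indicator_apply]
    split_ifs <;> simp_all
  have h2 : ∑ k, α k * (prob p (X k) * prob p (Y k)) = ∑ ω : Config E, ∑ ω' : Config E,
      weight p ω * weight p ω' * (∑ k, α k * if ω ∈ X k ∧ ω' ∈ Y k then 1 else 0) := by
    simp only [h1, Finset.mul_sum]
    rw [Finset.sum_comm]
    refine Finset.sum_congr rfl fun ω _ => ?_
    rw [Finset.sum_comm]
    refine Finset.sum_congr rfl fun ω' _ => ?_
    refine Finset.sum_congr rfl fun k _ => ?_
    ring
  have h3 := twoCopy_eq_sum_faces p (fun ω : Config E => ω)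
    (fun ω ω' => ∑ k, α k * if ω ∈ X k ∧ ω' ∈ Y k then 1 else 0)
  rw [h2, h3]
  refine Finset.sum_congr rfl fun uv _ => ?_
  congr 1
  split_ifs with hle
  · rw [Finset.sum_comm]
    refine Finset.sum_congr rfl fun k _ => ?_
    rw [← Finset.mul_sum, Finset.card_filter]
    push_cast
    rfl
  · rfl

end Transfer

/-- The seven families of the 6-mark inequality: coefficients `α(m, i, j)` (`m = 0`: `−½ [i≠j]` on
`B × B`, `1`: `−[i≠j]` on `B × C`, `2`: `[i≠j]` on `A × B`, `3`: `[i=j]` on `A × D`, `4`: `[j=0]` on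
`A × E`, `5`: `[i≠j]` on `C × D`, `6`: `½ [i≠j]` on `D × D`). -/
noncomputable def conc6Coef : Fin 7 → Fin 3 → Fin 3 → ℝ :=
  ![fun i j => if i ≠ j then -1 / 2 else 0, fun i j => if i ≠ j then -1 else 0,
    fun i j => if i ≠ j then 1 else 0, fun i j => if i = j then 1 else 0,
    fun _ j => if j = 0 then 1 else 0, fun i j => if i ≠ j then 1 else 0,
    fun i j => if i ≠ j then 1 / 2 else 0]

namespace MultiGraph

variable {V E : Type*} (G : MultiGraph V E) [DecidableEq E]

/-- The seven families: first factors `X(m, i)`. -/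
def conc6X (g : E) (a b c d : V) : Fin 7 → Fin 3 → Set (Config E) :=
  ![G.typeB g a b c d, G.typeB g a b c d, G.typeA g a b c d, G.typeA g a b c d,
    G.typeA g a b c d, G.typeC g a b c d, G.typeD g a b c d]

/-- The seven families: second factors `Y(m, j)`. -/
def conc6Y (g : E) (a b c d : V) : Fin 7 → Fin 3 → Set (Config E) :=
  ![G.typeB g a b c d, G.typeC g a b c d, G.typeB g a b c d, G.typeD g a b c d,
    fun _ => G.typeE g a b c d, G.typeD g a b c d, G.typeD g a b c d]

end MultiGraph

/-- **The class level implies the product level**: if the 6-mark inequality holds on every face as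
an inequality of ordered antipodal counts, it holds for the probabilities (two-copy face grouping,
`sum_prob_mul_prob_eq_sum_faces`). -/
theorem Concavity6Mark_of_Concavity6MarkClass (h : Concavity6MarkClass) : Concavity6Mark := by
  classical
  intro V E _ _ G p hp a b c d g
  have key := sum_prob_mul_prob_eq_sum_faces (ι := Fin 7 × Fin 3 × Fin 3) p
    (fun k => conc6Coef k.1 k.2.1 k.2.2) (fun k => G.conc6X g a b c d k.1 k.2.1)
    (fun k => G.conc6Y g a b c d k.1 k.2.2)
  have hnn : 0 ≤ ∑ k : Fin 7 × Fin 3 × Fin 3, conc6Coef k.1 k.2.1 k.2.2 *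
      (prob p (G.conc6X g a b c d k.1 k.2.1) * prob p (G.conc6Y g a b c d k.1 k.2.2)) := by
    rw [key]
    refine Finset.sum_nonneg fun uv _ => ?_
    refine mul_nonneg (mul_nonneg (weight_nonneg hp _) (weight_nonneg hp _)) ?_
    split_ifs with hle
    · have hc := h G a b c d g uv.1 uv.2 hle
      have hcR := (Nat.cast_le (α := ℝ)).mpr hc
      push_cast at hcR
      simp only [Fintype.sum_prod_type, Fin.sum_univ_seven, Fin.sum_univ_three, conc6Coef,
        MultiGraph.conc6X, MultiGraph.conc6Y] at hcR ⊢
      simp at hcR ⊢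
      linarith
    · exact le_rfl
  simp only [Fintype.sum_prod_type, Fin.sum_univ_seven, Fin.sum_univ_three, conc6Coef,
    MultiGraph.conc6X, MultiGraph.conc6Y] at hnn ⊢
  simp at hnn ⊢
  linarith

end PercRepro
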